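import Mathlib
import HarnessLib.Audit
import Summits.PneNP.PneNP.Theorems.ClusOshBasic
import Summits.PneNP.PneNP.Theorems.ClusHilbertBound

/-!
# Route ClusUniversalCertificate — the order-shattering rungs, typed (osh-P2.md §3, F1(e), F6)
(rung F-N1, cell pnp-ideate, crux `UniversalCertAll` = stmt-PneNP-19683; planner p1 g14, `HOME/pnp-ideate-p1/lines/osh-P2.md` and the typed sketch
`lines/osh-P2-UNREGISTERED.lean` — the level-set / projection / downshift definitions and the OPEN rungs VERBATIM as `@[conjecture]` nodes closable by name;
restricted-model combinatorics — nothing here bears on `P` versus `NP`)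

* `lvl`, `proj`, `dbl` — the level sets `Y⁰, Y¹`, the projection `U = Y⁰ ∪ Y¹` and the double fibres `I = Y⁰ ∩ Y¹` along the LAST coordinate;
* `supp`, `downAll`, `oshDown` (iterated down-compression, last coordinate first; `card_oshDown`);
* OPEN (`@[conjecture]`): `OshSucc` (F1(b), the recursion `S(Y) = S(U) + S(I) + |I|` — proved in print, open in the tree), `OshRung` (one block), `LastStep`, `OshTII`,
  `ColexStdIffDown` (F1(e), Mészáros–Rónyai), `OshRungDown`, `ShRung` (F6, the order-free headline);
* proved glue: `oshRungDown_iff_oshRung_of` (the downshift form equals the span form once F1(e) gives `S = W ∘ D`).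
-/

set_option linter.dupNamespace false -- `Summit.PneNP.PneNP.…`: summit = sub-problem name (D-0017 single-conjunct layout)

namespace Summit.PneNP.PneNP.Theorems.ClusHilbert.Osh

open Finset
open Summit.PneNP.PneNP.Theorems.ClusCube (V)
open Summit.PneNP.PneNP.Theorems.ClusHilbert (HF Phi dimAt lexRank chi resTo capId)

variable {N : ℕ}

/-! ## Splitting off the last coordinate -/

/-- the level sets `Y^b = {w : (w,b) ∈ Y}` as subsets of `𝔽₂^N`, for `Y ⊆ 𝔽₂^{N+1}` (last coordinate = least significant) -/
def lvl (Y : Finset (V (N + 1))) (b : ZMod 2) : Finset (V N) :=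
  (Y.filter fun y => y (Fin.last N) = b).image Fin.init

/-- `U = Y^0 ∪ Y^1` (the projection) -/
def proj (Y : Finset (V (N + 1))) : Finset (V N) := lvl Y 0 ∪ lvl Y 1

/-- `I = Y^0 ∩ Y^1` (the double fibres) -/
def dbl (Y : Finset (V (N + 1))) : Finset (V N) := lvl Y 0 ∩ lvl Y 1

/-- **F1(b) (OPEN in the tree; Friedl–Rónyai / Anstee–Rónyai–Sali, proved in print): the recursion `S(Y) = S(U) + S(I) + |I|`** along the largest variable.
FRONTIER. -/
@[conjecture] def OshSucc : Prop :=
  ∀ (N : ℕ) (Y : Finset (V (N + 1))), oshS Y = oshS (proj Y) + oshS (dbl Y) + (dbl Y).card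

/-! ## The rungs (OPEN; osh-P2.md §3) -/

/-- **(OSH-RUNG, one block; OPEN):** `S(Y) + Σ_y dim_Y(y) ≤ (N−1)|Y| + Σ_y a_lex(y) + 2^N·[Y = V]`.  Implies the Φ-form `oneBlockRung` by `Phi_le_oshS`.  FRONTIER. -/
@[conjecture] def OshRung (N : ℕ) : Prop :=
  ∀ Y : Finset (V N), oshS Y + ∑ y ∈ Y, dimAt Y y ≤ (N - 1) * Y.card + ∑ y ∈ Y, lexIncr Y y + (if Y = univ then 2 ^ N else 0)

/-- **(LAST-STEP; OPEN):** the flat-only compression inequality `Σ_Y def_Y + 2^N·[U = V' ≠ I] ≤ Σ_U def_U + Σ_I def_I + |U|`, `def = dim − a_lex`, written without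
subtraction.  FRONTIER. -/
@[conjecture] def LastStep (N : ℕ) : Prop :=
  ∀ Y : Finset (V (N + 1)),
    ∑ y ∈ Y, dimAt Y y + ∑ w ∈ proj Y, lexIncr (proj Y) w + ∑ w ∈ dbl Y, lexIncr (dbl Y) w
        + (if proj Y = univ ∧ dbl Y ≠ univ then 2 ^ N else 0)
      ≤ ∑ y ∈ Y, lexIncr Y y + ∑ w ∈ proj Y, dimAt (proj Y) w + ∑ w ∈ dbl Y, dimAt (dbl Y) w + (proj Y).card

/-- **(OSH-TII, all blocks of size 1; OPEN):** `S(Y) + Σ dim_Y ≤ cap_id(Y) + Σ a_lex` — NOT implied by the proved `tii`.  FRONTIER. -/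
@[conjecture] def OshTII (N : ℕ) : Prop :=
  ∀ Y : Finset (V N), oshS Y + ∑ y ∈ Y, dimAt Y y ≤ capId Y + ∑ y ∈ Y, lexIncr Y y

/-! ## Downshift form (F1(e)) -/

/-- support of a point of `𝔽₂^N` -/
def supp (x : V N) : Finset (Fin N) := univ.filter fun i => x i ≠ 0

/-- `supp` is injective. -/
theorem supp_injective : Function.Injective (supp (N := N)) := by
  intro x y h
  funext i
  have hx : i ∈ supp x ↔ i ∈ supp y := by rw [h]
  simp only [supp, mem_filter, mem_univ, true_and] at hx
  have key : ∀ a b : ZMod 2, (a ≠ 0 ↔ b ≠ 0) → a = b := by decide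
  exact key _ _ hx

/-- iterate down-compression along a list of coordinates, head first -/
def downAll : List (Fin N) → Finset (Finset (Fin N)) → Finset (Finset (Fin N))
  | [], 𝒜 => 𝒜
  | a :: l, 𝒜 => downAll l (Down.compression a 𝒜)

/-- Down-compression preserves the number of sets. -/
theorem card_downAll (l : List (Fin N)) (𝒜 : Finset (Finset (Fin N))) : (downAll l 𝒜).card = 𝒜.card := by
  induction l generalizing 𝒜 with
  | nil => rfl
  | cons a l ih => simp only [downAll, ih, Down.card_compression]

/-- `osh_colex(Y)` as a set family: compress coordinate `N-1` first, then `N-2, …, 0`. -/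
def oshDown (Y : Finset (V N)) : Finset (Finset (Fin N)) :=
  downAll (List.finRange N).reverse (Y.image supp)

/-- The compressed family has `|Y|` members. -/
theorem card_oshDown (Y : Finset (V N)) : (oshDown Y).card = Y.card := by
  unfold oshDown
  rw [card_downAll, card_image_of_injective _ supp_injective]

/-- **F1(e) (OPEN in the tree; Mészáros–Rónyai 2019, Thm 2, proved in print):** colex-standard sets = iterated downshift.  FRONTIER. -/
@[conjecture] def ColexStdIffDown : Prop :=
  ∀ (N : ℕ) (Y : Finset (V N)) (T : Finset (Fin N)), colexStd Y T ↔ T ∈ oshDown Y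

/-- **(OSH-RUNG, downshift form; OPEN — the statement provers should attack):** `W(D(Y)) + Σ_y dim_Y(y) ≤ (N−1)|Y| + Σ_y a_lex(y) + 2^N·[Y = V]`.  FRONTIER. -/
@[conjecture] def OshRungDown (N : ℕ) : Prop :=
  ∀ Y : Finset (V N), ∑ s ∈ oshDown Y, s.card + ∑ y ∈ Y, dimAt Y y
      ≤ (N - 1) * Y.card + ∑ y ∈ Y, lexIncr Y y + (if Y = univ then 2 ^ N else 0)

/-- **(SH-RUNG; OPEN — the order-free headline, F6):** for `Y ⊊ 𝔽₂^N` and every down-closed `𝒯 ⊆ shatterer (supp '' Y)` with `|𝒯| = |Y|`: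
`Σ_{T∈𝒯} |T| + Σ_y dim_Y(y) ≤ (N−1)|Y| + Σ_y a_lex(y)`.  FRONTIER. -/
@[conjecture] def ShRung (N : ℕ) : Prop :=
  ∀ Y : Finset (V N), Y ≠ univ → ∀ 𝒯 : Finset (Finset (Fin N)), 𝒯 ⊆ (Y.image supp).shatterer →
    IsLowerSet (𝒯 : Set (Finset (Fin N))) → 𝒯.card = Y.card →
      ∑ s ∈ 𝒯, s.card + ∑ y ∈ Y, dimAt Y y ≤ (N - 1) * Y.card + ∑ y ∈ Y, lexIncr Y y

/-! ## Glue -/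

/-- With F1(e), `S(Y)` is the total weight of the compressed family. -/
theorem oshS_eq_weight_of (h : ColexStdIffDown) (Y : Finset (V N)) : oshS Y = ∑ s ∈ oshDown Y, s.card := by
  classical
  unfold oshS
  rw [← sum_filter]
  refine sum_congr ?_ fun _ _ => rfl
  ext T
  rw [mem_filter, h N Y T]
  simp

/-- Hence the downshift form of the one-block rung is the span form. -/
theorem oshRungDown_iff_oshRung_of (h : ColexStdIffDown) (N : ℕ) : OshRungDown N ↔ OshRung N := by
  unfold OshRungDown OshRung
  simp only [oshS_eq_weight_of h]

/-- The one-block rung gives the Φ-form (by `Φ ≤ S`). -/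
theorem phiRung_of_oshRung {N : ℕ} (h : OshRung N) (Y : Finset (V N)) :
    Phi Y + ∑ y ∈ Y, dimAt Y y ≤ (N - 1) * Y.card + ∑ y ∈ Y, lexIncr Y y + (if Y = univ then 2 ^ N else 0) :=
  le_trans (Nat.add_le_add_right (Phi_le_oshS Y) _) (h Y)

end Summit.PneNP.PneNP.Theorems.ClusHilbert.Osh
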